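import Summits.AnomalousDissipation.AnomalousDissipation.Theorems.TaylorGreenLogLoudStates.Negative.Eigenforce

/-!
# Route MirrorVariety — corollaries of the eigenforce work identity (supports stmt-AnomalousDissipation-14587)

The planner's requested riders of the support item `EigenforceWorkIdentity` (stmt-AnomalousDissipation-14587):
for an admissible Galerkin steady Taylor–Green state `U` at `(N, ν)`, `N ≥ 2`,

* `loud_iff_transfer_deficit` (**LoudIffTransferDeficit**) — for `ν > 0`:
  `ε ≤ ν‖∇U‖² ↔ 12π²νε − 1/4 ≤ ∫⟪U, (U·∇)f_TG⟫`; loud / quiet is decided by ONE cubic functional, the transfer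
  out of the forcing shell, in the `O(ν)` layer;
* `abs_transfer_add_quarter_le` — for `ν ≥ 0` and `∫‖U‖² ≤ E`: `|(∫⟪U,(U·∇)f_TG⟫) + 1/4| ≤ 6π²ν√E`; the nonlinear
  flux out of the forcing shell of EVERY bounded steady TG state is pinned to `−1/4 + O(ν√E)`.

Both are two-line consequences of the landed `Negative.eigenforce_identity` (`12π²ν∫⟪f_TG,U⟫ = 1/4 + ∫⟪U,(U·∇)f_TG⟫`),
`Negative.energy_identity` (`ν‖∇U‖² = ∫⟪f_TG,U⟫`) and the sharp injection ceiling
`Negative.loudness_le_half_sqrt_energy` (`ν‖∇U‖² ≤ ½√(∫‖U‖²)`). The bounded-energy window complements the log-energy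
window `Negative.transfer_window` of the sibling crux. Sources: Temam 1979 Ch. II (1.25)/(1.29) [Temam1979]; folklore.
-/

-- `Summit.<Summit>.<Problem>` is the tree's mandated summit-side namespace (CONVENTIONS §2); for this
-- single-conjunct summit the two coincide, so the duplicate is deliberate.
set_option linter.dupNamespace false

noncomputable section

open scoped InnerProductSpace
open MeasureTheory
open Literature.Analysis.FunctionSpaces Literature.Analysis.FunctionSpaces.Torus

namespace Summit.AnomalousDissipation.AnomalousDissipation.Theorems.EigenforceWorkIdentity

open Summit.AnomalousDissipation.AnomalousDissipation.Theorems.TaylorGreenLoudGalerkinStates.Negative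
open Summit.AnomalousDissipation.AnomalousDissipation.Theorems.TaylorGreenLogLoudStates.Negative

/-- **Loud iff transfer deficit.** For an admissible Galerkin steady Taylor–Green state `U` at `(N, ν)`, `N ≥ 2`,
`ν > 0`, loudness `ε ≤ ν‖∇U‖²` is equivalent to the cubic transfer inequality
`12π²νε − 1/4 ≤ ∫⟪U, (U·∇)f_TG⟫`: by the eigenforce work identity `12π²ν · ν‖∇U‖² = 1/4 + ∫⟪U,(U·∇)f_TG⟫`,
so loud/quiet is decided by one cubic functional in the `O(ν)` layer. [folklore] -/
theorem loud_iff_transfer_deficit {ν ε : ℝ} {N : ℕ} {U : UnitAddTorus (Fin 3) → EuclideanSpace ℝ (Fin 3)}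
    (hν : 0 < ν) (hN : 2 ≤ N) (hU : IsSteadyState ν N tgForce U) :
    ε ≤ ν * gradNormSq U ↔ 12 * Real.pi ^ 2 * ν * ε - 1 / 4 ≤ ∫ x, ⟪U x, convect U tgForce x⟫_ℝ := by
  have hwork := eigenforce_identity hN hU
  rw [energy_identity hU continuous_tgForce]
  have hc : 0 < 12 * Real.pi ^ 2 * ν := by positivity
  constructor
  · intro h
    have h1 : 12 * Real.pi ^ 2 * ν * ε ≤ 12 * Real.pi ^ 2 * ν * ∫ x, ⟪tgForce x, U x⟫_ℝ :=
      mul_le_mul_of_nonneg_left h hc.le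
    linarith
  · intro h
    have h1 : 12 * Real.pi ^ 2 * ν * ε ≤ 12 * Real.pi ^ 2 * ν * ∫ x, ⟪tgForce x, U x⟫_ℝ := by linarith
    exact le_of_mul_le_mul_left h1 hc

/-- **Transfer out of the forcing shell is pinned.** For an admissible Galerkin steady Taylor–Green state at `(N, ν)`,
`N ≥ 2`, `ν ≥ 0`, with energy `∫‖U‖² ≤ E`: `|(∫⟪U,(U·∇)f_TG⟫) + 1/4| ≤ 6π²ν√E`
(work identity and the sharp injection ceiling `∫⟪f_TG,U⟫ = ν‖∇U‖² ≤ ½√(∫‖U‖²)`, with `ν‖∇U‖² ≥ 0`). [folklore] -/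
theorem abs_transfer_add_quarter_le {ν E : ℝ} {N : ℕ} {U : UnitAddTorus (Fin 3) → EuclideanSpace ℝ (Fin 3)}
    (hν : 0 ≤ ν) (hN : 2 ≤ N) (hU : IsSteadyState ν N tgForce U) (hE : ∫ x, ‖U x‖ ^ 2 ≤ E) :
    |(∫ x, ⟪U x, convect U tgForce x⟫_ℝ) + 1 / 4| ≤ 6 * Real.pi ^ 2 * ν * Real.sqrt E := by
  have hwork := eigenforce_identity hN hU
  have henergy := energy_identity hU continuous_tgForce
  have hceil := loudness_le_half_sqrt_energy hU
  have hsqrt : Real.sqrt (∫ x, ‖U x‖ ^ 2) ≤ Real.sqrt E := Real.sqrt_le_sqrt hE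
  have hI0 : 0 ≤ ν * gradNormSq U := mul_nonneg hν (gradNormSq_nonneg U)
  have hpi : 0 ≤ 12 * Real.pi ^ 2 * ν := by positivity
  rw [← henergy] at hwork
  have hT : (∫ x, ⟪U x, convect U tgForce x⟫_ℝ) + 1 / 4 = 12 * Real.pi ^ 2 * ν * (ν * gradNormSq U) := by
    linarith [hwork]
  have h3 : ν * gradNormSq U ≤ 2⁻¹ * Real.sqrt E :=
    hceil.trans (mul_le_mul_of_nonneg_left hsqrt (by norm_num))
  rw [hT, abs_of_nonneg (mul_nonneg hpi hI0)]
  calc 12 * Real.pi ^ 2 * ν * (ν * gradNormSq U) ≤ 12 * Real.pi ^ 2 * ν * (2⁻¹ * Real.sqrt E) :=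
        mul_le_mul_of_nonneg_left h3 hpi
    _ = 6 * Real.pi ^ 2 * ν * Real.sqrt E := by ring

end Summit.AnomalousDissipation.AnomalousDissipation.Theorems.EigenforceWorkIdentity

end
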